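import Literature.AnabelianGeometry.SemiGraphs.PSCCompactificationTransfer
import Literature.AnabelianGeometry.SemiGraphs.PSCNumericallyCuspidalOfRankProofs
import Literature.AnabelianGeometry.SemiGraphs.PSCEdgewiseCriterionProofs
import HarnessLib

/-!
# [CombGC] Theorem 1.6 (ii) for STURDY data: the induced isomorphism of the compactifications is graphic

Mochizuki, *A combinatorial version of the Grothendieck conjecture*, Tohoku Math. J. **59** (2007)
[CombGC], proof of Theorem 1.6 (ii), author's manuscript p. 14, l.16–31: for sturdy `G`, `H` and a
graphically filtration-preserving `α : Π_G ⥲ Π_H`, "by Proposition 1.3 [cf. Remark 1.3.1], … `α` is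
numerically cuspidal, hence [by assertion (i)] … group-theoretically cuspidal.  Thus, by replacing
`G`, `H` by their respective compactifications [cf. Remark 1.1.6], and replacing `α` by the isomorphism
induced by `α` between the respective quotients `Π_G ↠ Π^cpt_G`, `Π_H ↠ Π^cpt_H`, we may assume, without
loss of generality, that `G`, `H` are noncuspidal and sturdy. … Thus, to complete the proof of
assertion (ii), it suffices … to verify assertion (iii)."  This proof-only file COMPOSES the cell's
landed kernels into that passage, for one pair of sturdy data on profinite groups with `Σ = {l}`
(writer's assembly, sub-DAG `plan/L3/SUBDAG-CombGC-Thm16.md`, row T16-L00 (ii) / T16-L09):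

* `isGroupTheoreticallyCuspidal_of_isGraphicallyFiltrationPreserving_sturdy` — "numerically cuspidal,
  hence group-theoretically cuspidal": abc-iut-w5-d183's
  `isNumericallyCuspidal_of_isGraphicallyFiltrationPreserving_of_rankStatements` (Rmk. 1.3.1 inputs BY
  NAME) followed by abc-iut-w4-d052's `isGroupTheoreticallyCuspidal_of_isNumericallyCuspidal`
  (Thm. 1.6 (i) ⇒ at `Σ = {l}`, [IUTchI] Rmk. 1.2.3 (iv) cuspidal characterization BY NAME);
* `exists_compactified_graphic_of_inputs` — the induced `ᾱ : Π^cpt_G ⥲ Π^cpt_H` (any presentations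
  `f`, `f'` of the compactified quotients; abc-iut-w5-d188's `exists_over_of_ker_map_eq`,
  `IsGraphicallyFiltrationPreserving.compactifyAlong`) is GRAPHIC between the compactifications
  `G.compactifyAlong f`, `H.compactifyAlong f'` (abc-iut-L3-t4), by abc-iut-w4-d052's noncuspidal
  assembly `isGraphic_of_isGraphicallyFiltrationPreserving_of_inputs` — modulo, displayed BY NAME at
  the compactified data: the nodal characterization ([IUTchI] Rmk. 1.2.3 (v)), Thm. 1.6 (iii) for the
  induced `β`, the recovery `hrec` of verticial subgroups from `β` ("functorial bijection between the
  sets of vertices"), and Prop. 1.5 (ii);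
* `exists_compactified_graphic_holds` — the same over an origin predicate `Ω` whose data live on
  profinite groups, every input an `…Holds Ω` statement (`RankStatementsHold`,
  `CuspidalEdgeLikeCharacterizationHolds`, `CompactifyOfPSCTypeHolds`,
  `NodalEdgeLikeCharacterizationHolds`, `UnrVerticialIffHolds`, `GraphicIffEdgeLikeVerticialHolds`)
  except the displayed recovery schema `hrec`.

Proof-only (0 defs); nothing here takes a side on [IUTchIII] Cor. 3.12.
[cite: MochizukiCombGC2007, Thm 1.6(ii) p.14]
-/

noncomputable section

namespace Literature.AnabelianGeometry.SemiGraphs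

namespace PSCDatum

universe u

variable {P : Type u} [Group P] [TopologicalSpace P] [IsTopologicalGroup P] [CompactSpace P]
  [TotallyDisconnectedSpace P]
variable {P' : Type u} [Group P'] [TopologicalSpace P'] [IsTopologicalGroup P'] [CompactSpace P']
  [TotallyDisconnectedSpace P']
variable {G : PSCDatum P} {H : PSCDatum P'} {α : P ≃ₜ* P'}

/-- **"`α` is numerically cuspidal, hence [by assertion (i)] group-theoretically cuspidal"** (p. 14,
l.16–19), for sturdy `G`, `H` on profinite groups with `Σ = {l}`: composed from the Rmk. 1.3.1 rank
statements (abc-iut-w5-d183's kernel) and the cuspidal characterization of [IUTchI] Rmk. 1.2.3 (iv)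
(abc-iut-w4-d052's kernel of Thm. 1.6 (i)), all BY NAME. [cite: MochizukiCombGC2007, Thm 1.6(ii) p.14] -/
theorem isGroupTheoreticallyCuspidal_of_isGraphicallyFiltrationPreserving_sturdy {l : ℕ}
    (hS : G.Sigma = {l}) (hS' : H.Sigma = {l}) (hGs : G.IsSturdy) (hHs : H.IsSturdy)
    (hdG : G.DualityRankEq) (hcG : G.CuspRank) (hnG : G.NoncuspidalIffCuspFilTrivial)
    (hdH : H.DualityRankEq) (hcH : H.CuspRank) (hnH : H.NoncuspidalIffCuspFilTrivial)
    (hG₂ : G.CuspidalEdgeLikeCharacterization) (hH₂ : H.CuspidalEdgeLikeCharacterization)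
    (hα : G.IsGraphicallyFiltrationPreserving H α) : G.IsGroupTheoreticallyCuspidal H α := by
  have hlG : l ∈ G.Sigma := by rw [hS]; exact Set.mem_singleton l
  have hlH : l ∈ H.Sigma := by rw [hS']; exact Set.mem_singleton l
  have hl : l.Prime := G.sigma_prime l hlG
  exact isGroupTheoreticallyCuspidal_of_isNumericallyCuspidal hS hS' hG₂ hH₂
    (isNumericallyCuspidal_of_isGraphicallyFiltrationPreserving_of_rankStatements hl hlG hlH hGs hHs
      hdG hcG hnG hdH hcH hnH hα)

variable {Q : Type u} [Group Q] [TopologicalSpace Q] [IsTopologicalGroup Q] [CompactSpace Q]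
  [T2Space Q]
variable {Q' : Type u} [Group Q'] [TopologicalSpace Q'] [IsTopologicalGroup Q'] [CompactSpace Q']
  [T2Space Q']

/-- **Thm. 1.6 (ii) at the compactifications, for STURDY data** (p. 14, l.16–31): for sturdy `G`, `H`
on profinite groups with `Σ = {l}` and a graphically filtration-preserving `α`, and for any presentations
`f : Π_G ↠ Q`, `f' : Π_H ↠ Q'` of the compactified quotients (`ker f = Ker(Π_G ↠ Π^cpt_G)`, …), the
isomorphism `ᾱ : Q ⥲ Q'` induced by `α` exists and is GRAPHIC between `G.compactifyAlong f` and
`H.compactifyAlong f'` — granted, at the compactified (noncuspidal, sturdy) data and BY NAME: the nodal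
characterization [IUTchI] Rmk. 1.2.3 (v) (`hGn`, `hHn`), Thm. 1.6 (iii) for the induced `β` (`h3`), the
recovery of verticial subgroups from a group-theoretically verticial `β` (`hrec`, "functorial bijection
between the sets of vertices"), Prop. 1.5 (ii) (`hP15`), the node-existence bookkeeping
`hn : Nonempty G.graph.N ↔ Nonempty H.graph.N` (Rmk. 1.4.2 "`n(G') = deg · n(G)`", displayed; derived for
the inputs of the final assembly by `nonempty_nodes_iff_of_inputs`, `PSCNodeExistenceTransferProofs`); and
the rank / cuspidal-characterization inputs of the "group-theoretically cuspidal" step at `G`, `H`.  (Doc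
revision v2, abc-iut audit of abc-iut-w5-d212 F2: `hn` now listed.  The single-level `hrec` schema of this
theorem is SUPERSEDED by the level-wise route of `PSCThm16iiAssemblyProofs`
(`isGraphic_of_isGraphicallyFiltrationPreserving_holds`), which does not consume it.)
[cite: MochizukiCombGC2007, Thm 1.6(ii) p.14] -/
theorem exists_compactified_graphic_of_inputs
    (f : P →* Q) (hf : Continuous f) (hs : Function.Surjective f) (hkf : f.ker = G.cptKer)
    (f' : P' →* Q') (hf' : Continuous f') (hs' : Function.Surjective f') (hkf' : f'.ker = H.cptKer)
    {l : ℕ} (hS : G.Sigma = {l}) (hS' : H.Sigma = {l}) (hGs : G.IsSturdy) (hHs : H.IsSturdy)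
    (hdG : G.DualityRankEq) (hcG : G.CuspRank) (hnG : G.NoncuspidalIffCuspFilTrivial)
    (hdH : H.DualityRankEq) (hcH : H.CuspRank) (hnH : H.NoncuspidalIffCuspFilTrivial)
    (hG₂ : G.CuspidalEdgeLikeCharacterization) (hH₂ : H.CuspidalEdgeLikeCharacterization)
    (hn : Nonempty G.graph.N ↔ Nonempty H.graph.N)
    (hGn : (G.compactifyAlong f hf hs).NodalEdgeLikeCharacterization)
    (hHn : (H.compactifyAlong f' hf' hs').NodalEdgeLikeCharacterization)
    (h3 : ∀ β : (Q ⧸ (G.compactifyAlong f hf hs).unrKer) ≃ₜ* (Q' ⧸ (H.compactifyAlong f' hf' hs').unrKer),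
      (G.compactifyAlong f hf hs).UnrVerticiallyFiltrationPreservingIffVerticial
        (H.compactifyAlong f' hf' hs') β)
    (hrec : ∀ (ᾱ : Q ≃ₜ* Q')
      (β : (Q ⧸ (G.compactifyAlong f hf hs).unrKer) ≃ₜ* (Q' ⧸ (H.compactifyAlong f' hf' hs').unrKer)),
      (∀ x : Q, β (QuotientGroup.mk x) = QuotientGroup.mk (ᾱ x)) →
        (G.compactifyAlong f hf hs).IsUnrGroupTheoreticallyVerticial (H.compactifyAlong f' hf' hs') β →
          (G.compactifyAlong f hf hs).IsGroupTheoreticallyVerticial (H.compactifyAlong f' hf' hs') ᾱ)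
    (hP15 : ∀ ᾱ : Q ≃ₜ* Q',
      (G.compactifyAlong f hf hs).GraphicIffEdgeLikeVerticial (H.compactifyAlong f' hf' hs') ᾱ)
    (hα : G.IsGraphicallyFiltrationPreserving H α) :
    ∃ ᾱ : Q ≃ₜ* Q', (∀ x : P, ᾱ (f x) = f' (α x)) ∧
      (G.compactifyAlong f hf hs).IsGraphic (H.compactifyAlong f' hf' hs') ᾱ := by
  -- (i): `α` is group-theoretically cuspidal, hence carries `ker f = cptKer` onto `ker f' = cptKer`
  have hcusp : G.IsGroupTheoreticallyCuspidal H α :=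
    isGroupTheoreticallyCuspidal_of_isGraphicallyFiltrationPreserving_sturdy hS hS' hGs hHs hdG hcG hnG
      hdH hcH hnH hG₂ hH₂ hα
  have hker : f.ker.map α.toMulEquiv.toMonoidHom = f'.ker := by
    rw [hkf, hkf', map_cptKer_of_isGroupTheoreticallyCuspidal hcusp]
  -- the induced isomorphism of the compactified quotients
  obtain ⟨ᾱ, hᾱ⟩ := exists_over_of_ker_map_eq α hf hs hf' hs' hker
  refine ⟨ᾱ, hᾱ, ?_⟩
  -- the compactifications: noncuspidal, sturdy, `Σ = {l}`, and `ᾱ` graphically filtration-preserving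
  have hfp : (G.compactifyAlong f hf hs).IsGraphicallyFiltrationPreserving (H.compactifyAlong f' hf' hs') ᾱ :=
    hα.compactifyAlong G H f hf hs f' hf' hs' hker hkf.ge hkf'.ge hᾱ
  exact isGraphic_of_isGraphicallyFiltrationPreserving_of_inputs
    (G := G.compactifyAlong f hf hs) (H := H.compactifyAlong f' hf' hs') (α := ᾱ)
    (by rw [compactifyAlong_Sigma, hS]) (by rw [compactifyAlong_Sigma, hS'])
    (G.graph.compactify_isNoncuspidal) (H.graph.compactify_isNoncuspidal)
    ((G.isSturdy_compactifyAlong_iff f hf hs).mpr hGs) ((H.isSturdy_compactifyAlong_iff f' hf' hs').mpr hHs)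
    hn hGn hHn (fun β _ => h3 β) (fun β hβ => hrec ᾱ β hβ) (hP15 ᾱ) hfp

/-! ### Over an origin predicate with profinite data -/

section Origin

variable (Ω : PSCOrigin.{u})

/-- **Thm. 1.6 (ii) at the compactifications, for sturdy data of `Ω`-type** — every input an
origin-parametrised statement BY NAME (`RankStatementsHold`, `CuspidalEdgeLikeCharacterizationHolds`,
`CompactifyOfPSCTypeHolds`, `NodalEdgeLikeCharacterizationHolds`, `UnrVerticialIffHolds`,
`GraphicIffEdgeLikeVerticialHolds`) except profiniteness of the groups (instances) and the recovery
schema `hrec` ("α induces a functorial bijection between the sets of vertices", displayed; the job of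
the level-wise descent rows T16-L09b of the cell's sub-DAG): for sturdy `G`, `H` of `Ω`-type with
`Σ_G = Σ_H = {l}`, a graphically filtration-preserving `α`, and presentations `f`, `f'` of the
compactified quotients by compact Hausdorff groups, the induced `ᾱ` exists and is graphic between the
compactifications. [cite: MochizukiCombGC2007, Thm 1.6(ii) p.14] -/
theorem exists_compactified_graphic_holds (hrank : RankStatementsHold Ω) (hcuspΩ : CuspidalEdgeLikeCharacterizationHolds Ω)
    (hcpt : CompactifyOfPSCTypeHolds Ω) (hnodal : NodalEdgeLikeCharacterizationHolds Ω)
    (h3Ω : UnrVerticialIffHolds Ω) (hP15Ω : GraphicIffEdgeLikeVerticialHolds Ω)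
    (hrec : ∀ ⦃R : Type u⦄ [Group R] [TopologicalSpace R] [IsTopologicalGroup R]
      ⦃R' : Type u⦄ [Group R'] [TopologicalSpace R'] [IsTopologicalGroup R']
      (K : PSCDatum R) (L : PSCDatum R') (γ : R ≃ₜ* R')
      (β : (R ⧸ K.unrKer) ≃ₜ* (R' ⧸ L.unrKer)),
      Ω.IsOfPSCType K → Ω.IsOfPSCType L → K.graph.IsNoncuspidal → L.graph.IsNoncuspidal →
        (∀ x : R, β (QuotientGroup.mk x) = QuotientGroup.mk (γ x)) →
          K.IsUnrGroupTheoreticallyVerticial L β → K.IsGroupTheoreticallyVerticial L γ)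
    ⦃R : Type u⦄ [Group R] [TopologicalSpace R] [IsTopologicalGroup R] [CompactSpace R]
    [TotallyDisconnectedSpace R]
    ⦃R' : Type u⦄ [Group R'] [TopologicalSpace R'] [IsTopologicalGroup R'] [CompactSpace R']
    [TotallyDisconnectedSpace R']
    {G : PSCDatum R} {H : PSCDatum R'} {α : R ≃ₜ* R'}
    (hGΩ : Ω.IsOfPSCType G) (hHΩ : Ω.IsOfPSCType H)
    {l : ℕ} (hS : G.Sigma = {l}) (hS' : H.Sigma = {l}) (hGs : G.IsSturdy) (hHs : H.IsSturdy)
    (hn : Nonempty G.graph.N ↔ Nonempty H.graph.N) (hα : G.IsGraphicallyFiltrationPreserving H α)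
    ⦃S : Type u⦄ [Group S] [TopologicalSpace S] [IsTopologicalGroup S] [CompactSpace S] [T2Space S]
    ⦃S' : Type u⦄ [Group S'] [TopologicalSpace S'] [IsTopologicalGroup S'] [CompactSpace S'] [T2Space S']
    (f : R →* S) (hf : Continuous f) (hs : Function.Surjective f) (hkf : f.ker = G.cptKer)
    (f' : R' →* S') (hf' : Continuous f') (hs' : Function.Surjective f') (hkf' : f'.ker = H.cptKer) :
    ∃ ᾱ : S ≃ₜ* S', (∀ x : R, ᾱ (f x) = f' (α x)) ∧
      (G.compactifyAlong f hf hs).IsGraphic (H.compactifyAlong f' hf' hs') ᾱ := by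
  obtain ⟨-, hdG, hcG, hnG⟩ := hrank G hGΩ
  obtain ⟨-, hdH, hcH, hnH⟩ := hrank H hHΩ
  have hGcΩ : Ω.IsOfPSCType (G.compactifyAlong f hf hs) := hcpt G f hf hs hkf hGΩ hGs
  have hHcΩ : Ω.IsOfPSCType (H.compactifyAlong f' hf' hs') := hcpt H f' hf' hs' hkf' hHΩ hHs
  exact exists_compactified_graphic_of_inputs f hf hs hkf f' hf' hs' hkf' hS hS' hGs hHs hdG hcG hnG
    hdH hcH hnH (hcuspΩ G hGΩ) (hcuspΩ H hHΩ) hn (hnodal _ hGcΩ) (hnodal _ hHcΩ)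
    (fun β => h3Ω _ _ β hGcΩ hHcΩ)
    (fun ᾱ β hβ => hrec _ _ ᾱ β hGcΩ hHcΩ (G.graph.compactify_isNoncuspidal)
      (H.graph.compactify_isNoncuspidal) hβ)
    (fun ᾱ => hP15Ω _ _ ᾱ hGcΩ hHcΩ) hα

end Origin

end PSCDatum

end Literature.AnabelianGeometry.SemiGraphs

end

/-! ## Appended (abc-iut-w4-d052, writer's ROUTE 2): the EDGE-LIKE half at the compactifications, without (iii)

[CombGC] p. 14, l.22–24: "by Remark 1.4.4, the assumption that `α` is edge-wise filtration-preserving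
implies that `α` is group-theoretically edge-like" — at the compactified (noncuspidal, sturdy) data this
needs only the nodal characterization of [IUTchI] Rmk. 1.2.3 (v) (abc-iut-w4-d052's kernel
`isGroupTheoreticallyEdgeLike_of_isEdgewiseFiltrationPreserving`), NOT Theorem 1.6 (iii) nor the recovery
of verticial subgroups.  The resulting "`ᾱ` group-theoretically edge-like" at every Galois level is the
input of abc-iut-w5-d188's node-descent bridge (`PSCCompactifiedLevelBridgeNodes.lean`), whence "`α`
group-theoretically edge-like"; the verticial half goes through the unramified quotients of the covering
data directly (sub-DAG §ASSEMBLY SPEC, Route 2).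
-/

namespace Literature.AnabelianGeometry.SemiGraphs

namespace PSCDatum

universe u

variable {P : Type u} [Group P] [TopologicalSpace P] [IsTopologicalGroup P] [CompactSpace P]
  [TotallyDisconnectedSpace P]
variable {P' : Type u} [Group P'] [TopologicalSpace P'] [IsTopologicalGroup P'] [CompactSpace P']
  [TotallyDisconnectedSpace P']
variable {G : PSCDatum P} {H : PSCDatum P'} {α : P ≃ₜ* P'}
variable {Q : Type u} [Group Q] [TopologicalSpace Q] [IsTopologicalGroup Q] [CompactSpace Q]
  [T2Space Q]
variable {Q' : Type u} [Group Q'] [TopologicalSpace Q'] [IsTopologicalGroup Q'] [CompactSpace Q']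
  [T2Space Q']

/-- **"`ᾱ` is group-theoretically edge-like" at the compactifications, for STURDY data** (p. 14,
l.16–24): sturdy `G`, `H` on profinite groups with `Σ = {l}`, `α` graphically filtration-preserving,
`f`, `f'` presentations of the compactified quotients: the induced `ᾱ` exists (α is group-theoretically
cuspidal by the Rmk. 1.3.1 / Rmk. 1.2.3 (iv) inputs) and is group-theoretically edge-like between
`G.compactifyAlong f` and `H.compactifyAlong f'` — granted BY NAME only the nodal characterization of
[IUTchI] Rmk. 1.2.3 (v) at the compactified data and the node-existence correspondence `hn`.
[cite: MochizukiCombGC2007, Thm 1.6(ii) p.14] -/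
theorem exists_compactified_gtEdgeLike_of_inputs
    (f : P →* Q) (hf : Continuous f) (hs : Function.Surjective f) (hkf : f.ker = G.cptKer)
    (f' : P' →* Q') (hf' : Continuous f') (hs' : Function.Surjective f') (hkf' : f'.ker = H.cptKer)
    {l : ℕ} (hS : G.Sigma = {l}) (hS' : H.Sigma = {l}) (hGs : G.IsSturdy) (hHs : H.IsSturdy)
    (hdG : G.DualityRankEq) (hcG : G.CuspRank) (hnG : G.NoncuspidalIffCuspFilTrivial)
    (hdH : H.DualityRankEq) (hcH : H.CuspRank) (hnH : H.NoncuspidalIffCuspFilTrivial)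
    (hG₂ : G.CuspidalEdgeLikeCharacterization) (hH₂ : H.CuspidalEdgeLikeCharacterization)
    (hn : Nonempty G.graph.N ↔ Nonempty H.graph.N)
    (hGn : (G.compactifyAlong f hf hs).NodalEdgeLikeCharacterization)
    (hHn : (H.compactifyAlong f' hf' hs').NodalEdgeLikeCharacterization)
    (hα : G.IsGraphicallyFiltrationPreserving H α) :
    G.IsGroupTheoreticallyCuspidal H α ∧
      ∃ ᾱ : Q ≃ₜ* Q', (∀ x : P, ᾱ (f x) = f' (α x)) ∧
        (G.compactifyAlong f hf hs).IsGraphicallyFiltrationPreserving (H.compactifyAlong f' hf' hs') ᾱ ∧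
        (G.compactifyAlong f hf hs).IsGroupTheoreticallyEdgeLike (H.compactifyAlong f' hf' hs') ᾱ := by
  have hcusp : G.IsGroupTheoreticallyCuspidal H α :=
    isGroupTheoreticallyCuspidal_of_isGraphicallyFiltrationPreserving_sturdy hS hS' hGs hHs hdG hcG hnG
      hdH hcH hnH hG₂ hH₂ hα
  have hker : f.ker.map α.toMulEquiv.toMonoidHom = f'.ker := by
    rw [hkf, hkf', map_cptKer_of_isGroupTheoreticallyCuspidal hcusp]
  obtain ⟨ᾱ, hᾱ⟩ := exists_over_of_ker_map_eq α hf hs hf' hs' hker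
  have hfp : (G.compactifyAlong f hf hs).IsGraphicallyFiltrationPreserving (H.compactifyAlong f' hf' hs') ᾱ :=
    hα.compactifyAlong G H f hf hs f' hf' hs' hker hkf.ge hkf'.ge hᾱ
  refine ⟨hcusp, ᾱ, hᾱ, hfp, ?_⟩
  exact isGroupTheoreticallyEdgeLike_of_isEdgewiseFiltrationPreserving
    (G := G.compactifyAlong f hf hs) (H := H.compactifyAlong f' hf' hs') (α := ᾱ)
    (by rw [compactifyAlong_Sigma, hS]) (by rw [compactifyAlong_Sigma, hS'])
    (G.graph.compactify_isNoncuspidal) (H.graph.compactify_isNoncuspidal) hn hGn hHn hfp.2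

section OriginEdge

variable (Ω : PSCOrigin.{u})

/-- **The same over an origin predicate** (inputs `RankStatementsHold`,
`CuspidalEdgeLikeCharacterizationHolds`, `CompactifyOfPSCTypeHolds`, `NodalEdgeLikeCharacterizationHolds`
BY NAME; profiniteness as instances; `hn` displayed): for sturdy `G`, `H` of `Ω`-type with
`Σ_G = Σ_H = {l}` and graphically filtration-preserving `α`, the induced `ᾱ` of the compactifications is
graphically filtration-preserving and group-theoretically edge-like, and `α` is group-theoretically
cuspidal. [cite: MochizukiCombGC2007, Thm 1.6(ii) p.14] -/
theorem exists_compactified_gtEdgeLike_holds (hrank : RankStatementsHold Ω)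
    (hcuspΩ : CuspidalEdgeLikeCharacterizationHolds Ω) (hcpt : CompactifyOfPSCTypeHolds Ω)
    (hnodal : NodalEdgeLikeCharacterizationHolds Ω)
    ⦃R : Type u⦄ [Group R] [TopologicalSpace R] [IsTopologicalGroup R] [CompactSpace R]
    [TotallyDisconnectedSpace R]
    ⦃R' : Type u⦄ [Group R'] [TopologicalSpace R'] [IsTopologicalGroup R'] [CompactSpace R']
    [TotallyDisconnectedSpace R']
    {G : PSCDatum R} {H : PSCDatum R'} {α : R ≃ₜ* R'} (hGΩ : Ω.IsOfPSCType G) (hHΩ : Ω.IsOfPSCType H)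
    {l : ℕ} (hS : G.Sigma = {l}) (hS' : H.Sigma = {l}) (hGs : G.IsSturdy) (hHs : H.IsSturdy)
    (hn : Nonempty G.graph.N ↔ Nonempty H.graph.N) (hα : G.IsGraphicallyFiltrationPreserving H α)
    ⦃S : Type u⦄ [Group S] [TopologicalSpace S] [IsTopologicalGroup S] [CompactSpace S] [T2Space S]
    ⦃S' : Type u⦄ [Group S'] [TopologicalSpace S'] [IsTopologicalGroup S'] [CompactSpace S'] [T2Space S']
    (f : R →* S) (hf : Continuous f) (hs : Function.Surjective f) (hkf : f.ker = G.cptKer)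
    (f' : R' →* S') (hf' : Continuous f') (hs' : Function.Surjective f') (hkf' : f'.ker = H.cptKer) :
    G.IsGroupTheoreticallyCuspidal H α ∧
      ∃ ᾱ : S ≃ₜ* S', (∀ x : R, ᾱ (f x) = f' (α x)) ∧
        (G.compactifyAlong f hf hs).IsGraphicallyFiltrationPreserving (H.compactifyAlong f' hf' hs') ᾱ ∧
        (G.compactifyAlong f hf hs).IsGroupTheoreticallyEdgeLike (H.compactifyAlong f' hf' hs') ᾱ := by
  obtain ⟨-, hdG, hcG, hnG⟩ := hrank G hGΩ
  obtain ⟨-, hdH, hcH, hnH⟩ := hrank H hHΩ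
  have hGcΩ : Ω.IsOfPSCType (G.compactifyAlong f hf hs) := hcpt G f hf hs hkf hGΩ hGs
  have hHcΩ : Ω.IsOfPSCType (H.compactifyAlong f' hf' hs') := hcpt H f' hf' hs' hkf' hHΩ hHs
  exact exists_compactified_gtEdgeLike_of_inputs f hf hs hkf f' hf' hs' hkf' hS hS' hGs hHs hdG hcG hnG
    hdH hcH hnH (hcuspΩ G hGΩ) (hcuspΩ H hHΩ) hn (hnodal _ hGcΩ) (hnodal _ hHcΩ) hα

end OriginEdge

end PSCDatum

end Literature.AnabelianGeometry.SemiGraphs
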